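import Literature.AlgebraicGeometry.Modules.PullbackPushforwardCounitEpiProjective
import Literature.AlgebraicGeometry.Modules.InvertibleOfRankOne
import Literature.AlgebraicGeometry.Modules.Biduality
import Literature.AlgebraicGeometry.Modules.TensorUnitors
import Literature.AlgebraicGeometry.Modules.FlatStalksOfLocallyFree
import Literature.AlgebraicGeometry.Modules.DetClassTensor
import Literature.AlgebraicGeometry.Modules.PullbackTensorOfLocallyFree
import HarnessLib

/-!
# Twisting by a line bundle: `L ⊗ (L^∨ ⊗ M) ≅ M`, `L^∨ ⊗ L ≅ 𝒪_X`, and the twist of a short exact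
# sequence of vector bundles (The Stacks Project, Tag 0B8M; Hartshorne II Ex. 5.1)

Layer `Literature/AlgebraicGeometry/Modules`, namespace `Literature.AlgebraicGeometry.Modules`. THEOREMS ONLY
(`Nonempty (_ ≅ _)` / `∃` conclusions; no definition, no instance, no notation, no named fact, no `sorry`).

For an `𝒪_X`-module `L` which is finite locally free of rank one (a line bundle) the functor `L ⊗ –`
(`Modules.tensorBifunctor`, Stacks 01CA) is an equivalence with quasi-inverse `L^∨ ⊗ –`
(`Modules/InvertibleOfRankOne.isEquivalence_tensorBifunctor_obj_of_hasRank_one`, Stacks 0B8M). This file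
records the CANCELLATION ISOMORPHISMS of that proof as usable statements, and the elementary bookkeeping of
«twisting by a line bundle» that the projective-bundle step of the splitting construction consumes
(`HodgeTheory/ProjectiveBundleTautologicalQuotientOfGloballyGenerated`: `P(F) = P(F ⊗ L₀^∨)` with the
tautological sequence twisted back by `p^*L₀`):

* §1 `nonempty_tensorDualCancelNatIso` — `(L^∨ ⊗ –) ⋙ (L ⊗ –) ≅ 𝟭` (verbatim the right quasi-inverse of
  Stacks 0B8M in the tree's `𝓗om(L^∨, –)`-model: `L ⊗ (L^∨ ⊗ M) ≅ 𝓗om(L^∨, 𝓗om(L^∨∨, M)) ≅ M`, the rank-one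
  contraction `Modules/InvertibleOfRankOne.contractNatIso`); `nonempty_dualTensorCancelNatIso` — the same
  with `L` and `L^∨` exchanged (biduality `E ≅ E^∨∨`, Hartshorne II Ex. 5.1 (a), `Modules/Biduality`);
  the components `nonempty_tensorObj_tensorObj_dual_iso`, `nonempty_tensorObj_dual_tensorObj_iso`;
* §2 `nonempty_tensorObj_dual_iso_unit` / `nonempty_tensorObj_dual_iso_unit'` — the evaluation
  isomorphisms `L^∨ ⊗ L ≅ 𝒪_X ≅ L ⊗ L^∨` (unitor `Modules/TensorUnitors.tensorUnitRightIso`);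
* §3 free modules after twisting: `nonempty_free_punit_iso_tensorObj_dual` (`𝒪_X^{(1)} ≅ L^∨ ⊗ L`) and
  `nonempty_free_sum_iso_tensorObj_biprod` (`𝒪^{J₁} ≅ M ⊗ A`, `𝒪^{J₂} ≅ M ⊗ B` ⟹ `𝒪^{J₁ ⊕ J₂} ≅ M ⊗ (A ⊞ B)`,
  additivity of `M ⊗ –`, `Modules/InvertibleModule.additive_tensorBifunctor_obj`);
* §4 `exists_shortExact_tensorObj` — twisting a short exact sequence of modules of constant ranks `a`, `c`
  by a line bundle `M` gives a short exact sequence with the same ranks and middle term `M ⊗ X₂`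
  (`Modules/FlatStalksOfLocallyFree.shortExact_map_tensorBifunctor_obj_of_isFiniteLocallyFree`,
  `Modules/DetClassTensor.hasRank_tensorObj`); `nonempty_pullback_tensorObj_tensorObj_dual_iso` —
  `p^*L ⊗ p^*(L^∨ ⊗ F) ≅ p^*F` (`Modules/PullbackTensorOfLocallyFree.pullbackTensorIsoOfLeft` and §1).

Everything is proved; Mathlib has neither invertible sheaves on schemes nor their tensor calculus at this pin
(`Modules/TensorProduct` docstring).

## References

* The Stacks Project, Tag 0B8M (Modules, Lemma 17.25.4: locally free of rank `1` ⇒ invertible, quasi-inverse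
  `L^∨ ⊗ –`), Tag 0B8K, Tag 01CA (tensor product), Tag 05NE (flat modules). [StacksProject]
* R. Hartshorne, *Algebraic Geometry*, GTM 52 (1977), II Ex. 5.1 (a)–(d) (p. 123), II §7 p. 162
  (`P(E) ≅ P(E ⊗ L)`, Lemma 7.9). [Hartshorne1977]
-/

noncomputable section

universe u

open CategoryTheory CategoryTheory.Limits AlgebraicGeometry
open Literature.AlgebraicGeometry.Motives

namespace Literature.AlgebraicGeometry.Modules

variable {X : Scheme.{u}} {L : X.Modules}

/-! ## §1 The cancellation isomorphisms `L ⊗ (L^∨ ⊗ –) ≅ 𝟭` and `L^∨ ⊗ (L ⊗ –) ≅ 𝟭` -/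

/-- **`(L^∨ ⊗ –) ⋙ (L ⊗ –) ≅ 𝟭`** for a line bundle `L`: `L ⊗ (L^∨ ⊗ M) ≅ 𝓗om(L^∨, L^∨ ⊗ M) ≅
𝓗om(L^∨, 𝓗om(L^∨∨, M)) ≅ M`, the two `𝓗om`-models of tensoring by a vector bundle
(`tensorSheafHomDualNatIso`) followed by the rank-one contraction for `L^∨` (`contractNatIso`) — the right
quasi-inverse in the proof of Stacks 0B8M. [cite: StacksProject, Tag 0B8M (Modules, Lemma 17.25.4)]
[cite: Hartshorne1977, II Ex. 5.1 (b) (p. 123)] -/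
theorem nonempty_tensorDualCancelNatIso (hL : IsFiniteLocallyFree L) (h₁ : HasRank L 1) :
    Nonempty ((tensorBifunctor X).obj (dual L) ⋙ (tensorBifunctor X).obj L ≅ 𝟭 X.Modules) := by
  have hL' : IsFiniteLocallyFree (dual L) := isFiniteLocallyFree_dual hL
  have h₁' : HasRank (dual L) 1 := hasRank_dual h₁
  exact ⟨Functor.isoWhiskerLeft ((tensorBifunctor X).obj (dual L)) (tensorSheafHomDualNatIso L hL) ≪≫
    Functor.isoWhiskerRight (tensorSheafHomDualNatIso (dual L) hL') (sheafHomFunctor (dual L)) ≪≫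
      contractNatIso (dual L) hL' h₁'⟩

/-- `E ≅ E^∨∨` for a finite locally free `E` (biduality, Hartshorne II Ex. 5.1 (a); the tree's
`Modules/Biduality.isIso_toBidual` packaged as an isomorphism). [cite: Hartshorne1977, II Ex. 5.1 (a) (p. 123)] -/
theorem nonempty_iso_dual_dual {E : X.Modules} (hE : IsFiniteLocallyFree E) :
    Nonempty (E ≅ dual (dual E)) := by
  haveI := isIso_toBidual E hE
  exact ⟨asIso (toBidual E (unitModule X))⟩

/-- **`(L ⊗ –) ⋙ (L^∨ ⊗ –) ≅ 𝟭`** for a line bundle `L`: the previous isomorphism for the line bundle `L^∨`,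
transported along biduality `L ≅ L^∨∨` in the first tensor factor. [cite: StacksProject, Tag 0B8M (Modules, Lemma 17.25.4)]
[cite: Hartshorne1977, II Ex. 5.1 (a)–(b) (p. 123)] -/
theorem nonempty_dualTensorCancelNatIso (hL : IsFiniteLocallyFree L) (h₁ : HasRank L 1) :
    Nonempty ((tensorBifunctor X).obj L ⋙ (tensorBifunctor X).obj (dual L) ≅ 𝟭 X.Modules) := by
  have hL' : IsFiniteLocallyFree (dual L) := isFiniteLocallyFree_dual hL
  have h₁' : HasRank (dual L) 1 := hasRank_dual h₁
  obtain ⟨c⟩ := nonempty_tensorDualCancelNatIso hL' h₁'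
  obtain ⟨β⟩ := nonempty_iso_dual_dual hL
  exact ⟨Functor.isoWhiskerRight ((tensorBifunctor X).mapIso β) ((tensorBifunctor X).obj (dual L)) ≪≫ c⟩

/-- Component form: **`L ⊗ (L^∨ ⊗ M) ≅ M`** for a line bundle `L` and any module `M`.
[cite: StacksProject, Tag 0B8M (Modules, Lemma 17.25.4)] -/
theorem nonempty_tensorObj_tensorObj_dual_iso (hL : IsFiniteLocallyFree L) (h₁ : HasRank L 1) (M : X.Modules) :
    Nonempty (tensorObj L (tensorObj (dual L) M) ≅ M) := by
  obtain ⟨c⟩ := nonempty_tensorDualCancelNatIso hL h₁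
  exact ⟨c.app M⟩

/-- Component form: **`L^∨ ⊗ (L ⊗ M) ≅ M`** for a line bundle `L` and any module `M`.
[cite: StacksProject, Tag 0B8M (Modules, Lemma 17.25.4)] -/
theorem nonempty_tensorObj_dual_tensorObj_iso (hL : IsFiniteLocallyFree L) (h₁ : HasRank L 1) (M : X.Modules) :
    Nonempty (tensorObj (dual L) (tensorObj L M) ≅ M) := by
  obtain ⟨c⟩ := nonempty_dualTensorCancelNatIso hL h₁
  exact ⟨c.app M⟩

/-! ## §2 The evaluation isomorphisms `L^∨ ⊗ L ≅ 𝒪_X ≅ L ⊗ L^∨` -/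

/-- **`L^∨ ⊗ L ≅ 𝒪_X`** for a line bundle `L` (`L^∨ ⊗ L ≅ L^∨ ⊗ (L ⊗ 𝒪_X) ≅ 𝒪_X`: right unitor and §1).
[cite: StacksProject, Tag 0B8K (Modules, Lemma 17.25.2)] [cite: Hartshorne1977, II Ex. 5.1 (p. 123)] -/
theorem nonempty_tensorObj_dual_iso_unit (hL : IsFiniteLocallyFree L) (h₁ : HasRank L 1) :
    Nonempty (tensorObj (dual L) L ≅ unitModule X) := by
  obtain ⟨c⟩ := nonempty_tensorObj_dual_tensorObj_iso hL h₁ (unitModule X)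
  exact ⟨((tensorBifunctor X).obj (dual L)).mapIso (tensorUnitRightIso L).symm ≪≫ c⟩

/-- **`L ⊗ L^∨ ≅ 𝒪_X`** for a line bundle `L`. [cite: StacksProject, Tag 0B8K (Modules, Lemma 17.25.2)]
[cite: Hartshorne1977, II Ex. 5.1 (p. 123)] -/
theorem nonempty_tensorObj_dual_iso_unit' (hL : IsFiniteLocallyFree L) (h₁ : HasRank L 1) :
    Nonempty (tensorObj L (dual L) ≅ unitModule X) := by
  obtain ⟨c⟩ := nonempty_tensorObj_tensorObj_dual_iso hL h₁ (unitModule X)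
  exact ⟨((tensorBifunctor X).obj L).mapIso (tensorUnitRightIso (dual L)).symm ≪≫ c⟩

/-! ## §3 Free modules after twisting by `L^∨` -/

/-- **`𝒪_X^{(1)} ≅ L^∨ ⊗ L`**: the free module on one generator (Mathlib `SheafOfModules.free PUnit = ∐_{pt} 𝒪_X`,
`coproductUniqueIso`) is `𝒪_X ≅ L^∨ ⊗ L`. [cite: StacksProject, Tag 0B8K (Modules, Lemma 17.25.2)] -/
theorem nonempty_free_punit_iso_tensorObj_dual (hL : IsFiniteLocallyFree L) (h₁ : HasRank L 1) :
    Nonempty ((SheafOfModules.free (PUnit : Type u) : X.Modules) ≅ tensorObj (dual L) L) := by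
  obtain ⟨c⟩ := nonempty_tensorObj_dual_iso_unit hL h₁
  exact ⟨(coproductUniqueIso fun _ : (PUnit : Type u) => unitModule X) ≪≫ c.symm⟩

/-- **Twisting preserves finite freeness, one biproduct step**: if `𝒪^{J₁} ≅ M ⊗ A` and `𝒪^{J₂} ≅ M ⊗ B` then
`𝒪^{J₁ ⊕ J₂} ≅ M ⊗ (A ⊞ B)` (`M ⊗ –` is additive, `additive_tensorBifunctor_obj`, hence commutes with binary
biproducts, Mathlib `Functor.mapBiprod`; `𝒪^{J₁ ⊕ J₂} ≅ 𝒪^{J₁} ⊞ 𝒪^{J₂}`, `SheafOfModules.freeSumIsoBiprod`).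
[cite: StacksProject, Tag 01CA (Modules, Lemma 17.16.1: tensor product commutes with direct sums)] -/
theorem nonempty_free_sum_iso_tensorObj_biprod (M A B : X.Modules) {J₁ J₂ : Type u}
    (e₁ : SheafOfModules.free J₁ ≅ tensorObj M A) (e₂ : SheafOfModules.free J₂ ≅ tensorObj M B) :
    Nonempty ((SheafOfModules.free (J₁ ⊕ J₂) : X.Modules) ≅ tensorObj M (A ⊞ B)) := by
  haveI := additive_tensorBifunctor_obj (X := X) M
  haveI : PreservesBinaryBiproducts ((tensorBifunctor X).obj M) := preservesBinaryBiproducts_of_preservesBiproducts _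
  exact ⟨SheafOfModules.freeSumIsoBiprod J₁ J₂ ≪≫ biprod.mapIso e₁ e₂ ≪≫ (((tensorBifunctor X).obj M).mapBiprod A B).symm⟩

/-- **Twisting preserves epimorphisms**: `Epi φ ⟹ Epi (𝟙_M ⊗ φ)` (restated from
`Modules/PullbackPushforwardCounitEpiProjective.epi_tensorMap_id_of_epi` in functor form).
[cite: Hartshorne1977, II Ex. 5.1 (c) (p. 123)] -/
theorem epi_tensorBifunctor_obj_map (M : X.Modules) {A B : X.Modules} (φ : A ⟶ B) [Epi φ] :
    Epi (((tensorBifunctor X).obj M).map φ) :=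
  epi_tensorMap_id_of_epi M φ

/-! ## §4 Twisting a short exact sequence of vector bundles by a line bundle; pull-back -/

/-- **Twist of a short exact sequence by a line bundle.** For a line bundle `M` on `X` and a short exact
sequence `0 → X₁ → X₂ → X₃ → 0` of `𝒪_X`-modules with `X₁`, `X₃` of constant ranks `a`, `c`, the sequence
`0 → M ⊗ X₁ → M ⊗ X₂ → M ⊗ X₃ → 0` is short exact (tensoring by a finite locally free module is exact,
Stacks 05NE) with outer terms of the same ranks `a`, `c` (`rank (M ⊗ N) = rank M · rank N`). Stated with an
arbitrary module `N ≅ X₂` in the middle. [cite: StacksProject, Tag 05NE (Modules, Lemma 17.17.2)]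
[cite: StacksProject, Tag 01CE (Modules, Lemma 17.16.6 (7))] -/
theorem exists_shortExact_tensorObj {M N : X.Modules} (hM : IsFiniteLocallyFree M) (hM₁ : HasRank M 1)
    {S : ShortComplex X.Modules} (hS : S.ShortExact) {a c : ℕ} (ha : HasRank S.X₁ a) (hc : HasRank S.X₃ c)
    (e : S.X₂ ≅ N) :
    ∃ S' : ShortComplex X.Modules, S'.ShortExact ∧ HasRank S'.X₁ a ∧ HasRank S'.X₃ c ∧
      Nonempty (S'.X₂ ≅ tensorObj M N) := by
  haveI := additive_tensorBifunctor_obj (X := X) M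
  refine ⟨S.map ((tensorBifunctor X).obj M), shortExact_map_tensorBifunctor_obj_of_isFiniteLocallyFree hM hS,
    ?_, ?_, ⟨((tensorBifunctor X).obj M).mapIso e⟩⟩
  · simpa using hasRank_tensorObj hM₁ ha
  · simpa using hasRank_tensorObj hM₁ hc

/-- **Untwisting after pull-back: `p^*L ⊗ p^*(L^∨ ⊗ F) ≅ p^*F`** for a line bundle `L` on `Y`, any `𝒪_Y`-module
`F` and any morphism `p : X ⟶ Y` (`p^*L ⊗ p^*G ≅ p^*(L ⊗ G)`, pull-back commutes with tensoring by a vector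
bundle, Stacks 01CD; then §1). [cite: StacksProject, Tag 01CD (Modules, Lemma 17.16.4)]
[cite: StacksProject, Tag 0B8M (Modules, Lemma 17.25.4)] -/
theorem nonempty_pullback_tensorObj_tensorObj_dual_iso {X Y : Scheme.{u}} (p : X ⟶ Y) {L : Y.Modules}
    (hL : IsFiniteLocallyFree L) (h₁ : HasRank L 1) (F : Y.Modules) :
    Nonempty (tensorObj ((Scheme.Modules.pullback p).obj L)
        ((Scheme.Modules.pullback p).obj (tensorObj (dual L) F)) ≅ (Scheme.Modules.pullback p).obj F) := by
  obtain ⟨c⟩ := nonempty_tensorObj_tensorObj_dual_iso hL h₁ F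
  exact ⟨(pullbackTensorIsoOfLeft p hL (tensorObj (dual L) F)).symm ≪≫ (Scheme.Modules.pullback p).mapIso c⟩

end Literature.AlgebraicGeometry.Modules

end
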